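import Summits.QuantumFields.BalabanUV.T4Continuum.Support.ScalarCovariantCTWeighted
import Summits.QuantumFields.BalabanUV.Beta.AccretiveCombesThomas

/-!
# T⁴ programme, SUBSTRATE (shared lattice-gauge analysis library) — WEIGHTED COERCIVITY AS THE COMBES–THOMAS INTERFACE:
# local pieces enter through their `cosh` row defects, BOUNDED NON-LOCAL pieces through the operator norm of their conjugation defect
# `‖W_κ K W_κ⁻¹ − K‖`, and every decay statement (pairing, weighted solution, weighted Gram) is read off the weighted coercivity alone
# (programme VEC, file 1: the engine for operators with a non-local bounded part, e.g. the `∂P∂*` term of [B5] (1.69) ∕ [B9] (3.26))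

Substrate cell `b2b-balaban-substrate-*`, seat p3.  The tree's Combes–Thomas engine (`Beta.DeltaACombesThomas.combesThomas_pairwise`, and
this seat's `ScalarCovariantCTWeighted`) takes the ROW-DEFECT bound `ctRowDefect A κ ρ ≤ J` of the WHOLE kernel `A`.  For Bałaban's
propagators with the gauge term (`Δ_a = Δ − ∂P∂* + aQ*Q`, [Balaban1984PropagatorsI] (1.69) p.29; `Δ_a(U) = Δ_U + DR(U)D* + Q*aQ`,
[Balaban1985BackgroundPropagators] (3.26) p.395) the projection term is NOT finite-range, and an ENTRYWISE row-defect bound for it needs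
sup-norm control of `G′` (this is why `Beta.DeltaACombesThomasSets` carries the (1.126)-type hypothesis `hP`).  At the OPERATOR level,
however, the conjugated projection term is controlled by ℓ² bounds only (the weighted Gram bounds of `ScalarCovariantCTWeighted`).
THIS FILE sets up the interface that lets the two kinds of pieces be combined:

 * §1 the conjugated kernel **`conjMat κ ρ σ X (e, e′) = e^{κ(ρ_e − σ_{e′})}·X(e, e′)`** (row weight `ρ`, column weight `σ`; rectangular), its
   action `conjMat_mulVec` (`= e^{κρ}·X·e^{−κσ}`), and the link `conjForm_eq` with the conjugated quadratic form
   **`Beta.AccretiveCombesThomas.conjForm A κ ρ z`** `= ⟨z, conjMat κ ρ ρ A z⟩` (`= Σ_{e,e′} z̄_e e^{κ(ρ_e−ρ_{e′})}A(e,e′)z_{e′}`; REUSED from the β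
   cell's accretive Combes–Thomas module together with `conjForm_add`, `combesThomas_of_conjCoercive`, `isUnit_of_conjCoercive` — the predicate
   `WCoercive` below UNFOLDS to that module's «conjugated-coercive» hypothesis shape, so the two libraries are interchangeable);
 * §2 the **conjugation defect** `ConjDefect A κ ρ J := ∀ z, |Re conjForm A z − Re⟨z, Az⟩| ≤ J·‖z‖²` with the two SOURCES:
   **`conjDefect_of_rowDefect`** (Hermitian `A`, `ctRowDefect A κ ρ ≤ J` — the cosh symmetrisation, both directions) and
   **`conjDefect_of_opNorm`** (`‖conjMat κ ρ ρ K − K‖ ≤ J` — any bounded `K`), and `ConjDefect.add` ∕ `.smul_real`-free algebra (`add`, `neg`, `sub`);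
 * §3 the **weighted coercivity** `WCoercive A κ ρ γw := ∀ z, γw·‖z‖² ≤ Re conjForm A z`, obtained from `Coercive γ A` and `ConjDefect A κ ρ J` as
   **`wCoercive_of_coercive`** (`γw = γ − J`), and its consequences for `Ax = v`, `z = e^{κρ}x`, `w = e^{κρ}v`:
   **`WCoercive.solution_bound`** (`γw·‖z‖ ≤ ‖w‖`), **`WCoercive.pairing_decay`** (`|⟨u, x⟩| ≤ e^{−κR}/γw·‖u‖‖v‖` for `v` supported in
   `{ρ ≤ 0}`, `u` in `{ρ ≥ R}`, `κ ≥ 0` — this IS `AccretiveCombesThomas.combesThomas_of_conjCoercive`), **`WCoercive.form_bound`**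
   (`Re⟨z, Az⟩ ≤ (1/γw + J/γw²)·‖w‖²` given `ConjDefect A κ ρ J`) and **`WCoercive.gram_bound`** (`A = XᴴX + Y`, `Y ⪰ 0`:
   `‖Xz‖² ≤ (1/γw + J/γw²)·‖w‖²`); `WCoercive.isUnit` (`= AccretiveCombesThomas.isUnit_of_conjCoercive`).

HONEST FRAMING (T4-DAG p. 1).  Generic finite-dimensional linear algebra ([folklore]: Combes–Thomas 1973 ∕ Agmon, operator-level variant);
no estimate of any NE row; nothing printed is a hypothesis or a conclusion; the `def`s are the conjugated kernel∕form and two predicates on DATA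
(no `def … : Prop` FACT); spine 0/9 unchanged; NOT infinite volume ∕ mass gap ∕ Clay.  HONEST DEPENDENCY: continuum YM on T⁴ ⇐ BetaPertH ∧ nine
spine estimates (0/9 proved); BetaPertH ⇐ (D1) ∧ (D4) ∧ CAP+tail; G-an2-4 gates asym, D1 and NE2/3/4.  ABSOLUTE RULE kept; no `sorry`.
-/

noncomputable section

open scoped BigOperators ComplexConjugate Matrix Matrix.Norms.L2Operator ComplexOrder

namespace Summit.QuantumFields.BalabanUV.T4Continuum.CTWeightedCoercivity

open Literature.MathematicalPhysics.QuantumFieldTheory.Balaban1983to89.B5Prop11Lower (nsq nsq_nonneg norm_star_dotProduct_le nsq_mulVec_le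
  norm_form_le)
open Literature.MathematicalPhysics.QuantumFieldTheory.Balaban1983to89.Beta.DeltaACombesThomas (ctWeight ctRowDefect ctRowDefect_neg)
open Summit.QuantumFields.BalabanUV.Beta.AccretiveCombesThomas (conjForm conjForm_add combesThomas_of_conjCoercive isUnit_of_conjCoercive)
open Summit.QuantumFields.BalabanUV.T4Continuum
open Summit.QuantumFields.BalabanUV.T4Continuum.CoerciveInverseTower (Coercive)
open Summit.QuantumFields.BalabanUV.T4Continuum.GaugeTermResolventBounds (nsq_le_re_form)
open Summit.QuantumFields.BalabanUV.T4Continuum.ScalarCovariantCTWeighted (wvec wvec_wvec_neg dotProduct_wvec nsq_wvec_le_of_nonpos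
  sqrt_nsq_wvec_neg_le re_form_le_conj_add conj_form_eq_dot)

variable {ι τ σ' : Type*} [Fintype ι] [DecidableEq ι] [Fintype τ] [DecidableEq τ]

/-! ## §1 The conjugated kernel and the conjugated form -/

/-- **the conjugated kernel** `(W_ρ X W_σ⁻¹)(e, e′) = e^{κ(ρ_e − σ_{e′})}·X(e, e′)` (row weight `ρ`, column weight `σ`). [folklore] -/
def conjMat (κ : ℝ) (ρ : τ → ℝ) (σ : ι → ℝ) (X : Matrix τ ι ℂ) : Matrix τ ι ℂ :=
  Matrix.of fun e e' => ((Real.exp (κ * (ρ e - σ e')) : ℝ) : ℂ) * X e e'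

omit [Fintype ι] [DecidableEq ι] [Fintype τ] [DecidableEq τ] in
/-- entries. [folklore] -/
theorem conjMat_apply (κ : ℝ) (ρ : τ → ℝ) (σ : ι → ℝ) (X : Matrix τ ι ℂ) (e : τ) (e' : ι) :
    conjMat κ ρ σ X e e' = ((Real.exp (κ * (ρ e - σ e')) : ℝ) : ℂ) * X e e' := rfl

omit [DecidableEq ι] [Fintype τ] [DecidableEq τ] in
/-- **`conjMat X = e^{κρ}·X·e^{−κσ}`** on vectors. [folklore] -/
theorem conjMat_mulVec (κ : ℝ) (ρ : τ → ℝ) (σ : ι → ℝ) (X : Matrix τ ι ℂ) (z : ι → ℂ) :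
    conjMat κ ρ σ X *ᵥ z = wvec κ ρ (X *ᵥ wvec (-κ) σ z) := by
  funext e
  simp only [Matrix.mulVec, dotProduct, conjMat_apply, wvec, Finset.mul_sum]
  refine Finset.sum_congr rfl fun e' _ => ?_
  rw [show κ * (ρ e - σ e') = κ * ρ e + -κ * σ e' by ring, Real.exp_add, Complex.ofReal_mul]
  ring

omit [DecidableEq ι] [Fintype τ] [DecidableEq τ] in
/-- equivalently `e^{κρ}·(Xx) = conjMat X (e^{κσ}x)`. [folklore] -/
theorem wvec_mulVec (κ : ℝ) (ρ : τ → ℝ) (σ : ι → ℝ) (X : Matrix τ ι ℂ) (x : ι → ℂ) :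
    wvec κ ρ (X *ᵥ x) = conjMat κ ρ σ X *ᵥ wvec κ σ x := by
  rw [conjMat_mulVec]
  congr 2
  funext e
  simp only [wvec]
  rw [← mul_assoc, ← Complex.ofReal_mul, ← Real.exp_add, show -κ * σ e + κ * σ e = 0 by ring, Real.exp_zero, Complex.ofReal_one, one_mul]

omit [Fintype ι] [DecidableEq ι] [Fintype τ] [DecidableEq τ] in
/-- at `κ = 0` nothing happens. [folklore] -/
theorem conjMat_zero (ρ : τ → ℝ) (σ : ι → ℝ) (X : Matrix τ ι ℂ) : conjMat 0 ρ σ X = X := by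
  ext e e'; simp [conjMat_apply]

omit [Fintype ι] [DecidableEq ι] [Fintype τ] [DecidableEq τ] in
/-- additivity. [folklore] -/
theorem conjMat_add (κ : ℝ) (ρ : τ → ℝ) (σ : ι → ℝ) (X Y : Matrix τ ι ℂ) :
    conjMat κ ρ σ (X + Y) = conjMat κ ρ σ X + conjMat κ ρ σ Y := by
  ext e e'; simp [conjMat_apply, mul_add]

omit [Fintype ι] [DecidableEq ι] [Fintype τ] [DecidableEq τ] in
/-- subtraction. [folklore] -/
theorem conjMat_sub (κ : ℝ) (ρ : τ → ℝ) (σ : ι → ℝ) (X Y : Matrix τ ι ℂ) :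
    conjMat κ ρ σ (X - Y) = conjMat κ ρ σ X - conjMat κ ρ σ Y := by
  ext e e'; simp [conjMat_apply, mul_sub]

omit [Fintype ι] [DecidableEq ι] [Fintype τ] [DecidableEq τ] in
/-- scalars. [folklore] -/
theorem conjMat_smul (κ : ℝ) (ρ : τ → ℝ) (σ : ι → ℝ) (c : ℂ) (X : Matrix τ ι ℂ) :
    conjMat κ ρ σ (c • X) = c • conjMat κ ρ σ X := by
  ext e e'; simp [conjMat_apply]; ring

omit [DecidableEq ι] [Fintype τ] [DecidableEq τ] in
/-- **multiplicativity**: `W_ρ(XY)W_τ⁻¹ = (W_ρXW_σ⁻¹)(W_σYW_τ⁻¹)`. [folklore] -/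
theorem conjMat_mul {υ : Type*} [Fintype υ] (κ : ℝ) (ρ : τ → ℝ) (σ : ι → ℝ) (ν : υ → ℝ) (X : Matrix τ ι ℂ) (Y : Matrix ι υ ℂ) :
    conjMat κ ρ ν (X * Y) = conjMat κ ρ σ X * conjMat κ σ ν Y := by
  ext e e''
  simp only [conjMat_apply, Matrix.mul_apply, Finset.mul_sum]
  refine Finset.sum_congr rfl fun e' _ => ?_
  rw [show κ * (ρ e - ν e'') = κ * (ρ e - σ e') + κ * (σ e' - ν e'') by ring, Real.exp_add, Complex.ofReal_mul]
  ring

omit [Fintype τ] [DecidableEq τ] [Fintype ι] in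
/-- the identity is fixed. [folklore] -/
theorem conjMat_one (κ : ℝ) (ρ : ι → ℝ) : conjMat κ ρ ρ (1 : Matrix ι ι ℂ) = 1 := by
  ext e e'
  rw [conjMat_apply, Matrix.one_apply]
  by_cases h : e = e'
  · subst h; simp
  · simp [h]

omit [DecidableEq ι] in
/-- `conjForm A z = ⟨z, conjMat A z⟩` (`conjForm` = `Beta.AccretiveCombesThomas.conjForm`, the double sum `Σ z̄_e e^{κ(ρ_e−ρ_{e′})}A(e,e′)z_{e′}`).
[folklore] -/
theorem conjForm_eq (A : Matrix ι ι ℂ) (κ : ℝ) (ρ : ι → ℝ) (z : ι → ℂ) : conjForm A κ ρ z = star z ⬝ᵥ (conjMat κ ρ ρ A *ᵥ z) := by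
  rw [conjForm, dotProduct]
  refine Finset.sum_congr rfl fun e _ => ?_
  rw [Pi.star_apply, Complex.star_def, Matrix.mulVec, dotProduct, Finset.mul_sum]
  exact Finset.sum_congr rfl fun e' _ => by rw [conjMat_apply]; ring

/-! ## §2 The conjugation defect and its two sources -/

/-- **the conjugation defect**: the conjugated form differs from the form by at most `J·‖z‖²` in real part. [folklore] -/
def ConjDefect (A : Matrix ι ι ℂ) (κ : ℝ) (ρ : ι → ℝ) (J : ℝ) : Prop :=
  ∀ z : ι → ℂ, |(conjForm A κ ρ z).re - (star z ⬝ᵥ (A *ᵥ z)).re| ≤ J * nsq z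

omit [DecidableEq ι] in
/-- defects add. [folklore] -/
theorem ConjDefect.add {A B : Matrix ι ι ℂ} {κ : ℝ} {ρ : ι → ℝ} {J J' : ℝ} (hA : ConjDefect A κ ρ J) (hB : ConjDefect B κ ρ J') :
    ConjDefect (A + B) κ ρ (J + J') := fun z => by
  rw [conjForm_add, Matrix.add_mulVec, dotProduct_add, Complex.add_re, Complex.add_re, add_mul]
  have h1 := hA z; have h2 := hB z
  rw [abs_le] at h1 h2 ⊢
  constructor <;> linarith [h1.1, h1.2, h2.1, h2.2]

omit [DecidableEq ι] in
/-- the defect is monotone in the constant. [folklore] -/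
theorem ConjDefect.mono {A : Matrix ι ι ℂ} {κ : ℝ} {ρ : ι → ℝ} {J J' : ℝ} (hA : ConjDefect A κ ρ J) (hJ : J ≤ J') : ConjDefect A κ ρ J' :=
  fun z => (hA z).trans (mul_le_mul_of_nonneg_right hJ (nsq_nonneg _))

omit [DecidableEq ι] in
/-- **SOURCE 1 — LOCAL PIECES**: a Hermitian kernel with `cosh` row defects `≤ J` has conjugation defect `≤ J` (the symmetrisation of
`Beta.DeltaACombesThomas`, both directions). [folklore] -/
theorem conjDefect_of_rowDefect {A : Matrix ι ι ℂ} (hA : A.IsHermitian) {κ : ℝ} {ρ : ι → ℝ} {J : ℝ} (hJ : ∀ e, ctRowDefect A κ ρ e ≤ J) :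
    ConjDefect A κ ρ J := by
  intro z
  -- upper direction: `Re⟨z,Az⟩ ≤ Re conjForm A z + J‖z‖²`
  have hup : (star z ⬝ᵥ (A *ᵥ z)).re ≤ (conjForm A κ ρ z).re + J * nsq z := re_form_le_conj_add A hA κ ρ hJ z
  -- lower direction: the same lemma for `−A` (same row defects)
  have hJ' : ∀ e, ctRowDefect (-A) κ ρ e ≤ J := fun e => by rw [ctRowDefect_neg]; exact hJ e
  have hdn := re_form_le_conj_add (-A) hA.neg κ ρ hJ' z
  have e1 : (star z ⬝ᵥ ((-A) *ᵥ z)).re = -(star z ⬝ᵥ (A *ᵥ z)).re := by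
    rw [Matrix.neg_mulVec, dotProduct_neg, Complex.neg_re]
  have e2 : (∑ e, ∑ e', (starRingEnd ℂ) (z e) * ((Real.exp (κ * (ρ e - ρ e')) : ℝ) : ℂ) * (-A) e e' * z e').re
      = -(conjForm A κ ρ z).re := by
    rw [conjForm, ← Complex.neg_re, ← Finset.sum_neg_distrib]
    congr 1
    refine Finset.sum_congr rfl fun e _ => ?_
    rw [← Finset.sum_neg_distrib]
    exact Finset.sum_congr rfl fun e' _ => by rw [Matrix.neg_apply]; ring
  rw [e1, e2] at hdn
  rw [abs_le]
  constructor <;> linarith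

/-- **SOURCE 2 — BOUNDED NON-LOCAL PIECES**: `‖conjMat κ ρ ρ K − K‖ ≤ J` gives conjugation defect `≤ J` (no symmetry needed). [folklore] -/
theorem conjDefect_of_opNorm {K : Matrix ι ι ℂ} {κ : ℝ} {ρ : ι → ℝ} {J : ℝ} (hK : ‖conjMat κ ρ ρ K - K‖ ≤ J) : ConjDefect K κ ρ J := by
  intro z
  rw [conjForm_eq]
  have e : star z ⬝ᵥ (conjMat κ ρ ρ K *ᵥ z) - star z ⬝ᵥ (K *ᵥ z) = star z ⬝ᵥ ((conjMat κ ρ ρ K - K) *ᵥ z) := by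
    rw [Matrix.sub_mulVec, dotProduct_sub]
  rw [← Complex.sub_re, e]
  have h := norm_form_le (conjMat κ ρ ρ K - K) z z
  have hsq : Real.sqrt (nsq z) * Real.sqrt (nsq z) = nsq z := Real.mul_self_sqrt (nsq_nonneg _)
  calc |(star z ⬝ᵥ ((conjMat κ ρ ρ K - K) *ᵥ z)).re| ≤ ‖star z ⬝ᵥ ((conjMat κ ρ ρ K - K) *ᵥ z)‖ := Complex.abs_re_le_norm _
    _ ≤ ‖conjMat κ ρ ρ K - K‖ * (Real.sqrt (nsq z) * Real.sqrt (nsq z)) := h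
    _ ≤ J * nsq z := by rw [hsq]; exact mul_le_mul_of_nonneg_right hK (nsq_nonneg _)

/-! ## §3 Weighted coercivity and its consequences -/

/-- **weighted coercivity**: `γw·‖z‖² ≤ Re conjForm A z` for all `z`. [folklore] -/
def WCoercive (A : Matrix ι ι ℂ) (κ : ℝ) (ρ : ι → ℝ) (γw : ℝ) : Prop :=
  ∀ z : ι → ℂ, γw * nsq z ≤ (conjForm A κ ρ z).re

omit [DecidableEq ι] in
/-- **coercivity + conjugation defect ⟹ weighted coercivity** with `γw = γ − J`. [folklore] -/
theorem wCoercive_of_coercive {A : Matrix ι ι ℂ} {γ : ℝ} (hco : Coercive γ A) {κ : ℝ} {ρ : ι → ℝ} {J : ℝ} (hJ : ConjDefect A κ ρ J) :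
    WCoercive A κ ρ (γ - J) := fun z => by
  have h1 := hco z
  have h2 := hJ z
  rw [abs_le] at h2
  rw [sub_mul]
  linarith [h2.1]

omit [DecidableEq ι] in
/-- monotonicity. [folklore] -/
theorem WCoercive.mono {A : Matrix ι ι ℂ} {κ : ℝ} {ρ : ι → ℝ} {γw γw' : ℝ} (h : WCoercive A κ ρ γw) (hle : γw' ≤ γw) :
    WCoercive A κ ρ γw' := fun z => (mul_le_mul_of_nonneg_right hle (nsq_nonneg _)).trans (h z)

namespace WCoercive

variable {A : Matrix ι ι ℂ} {κ : ℝ} {ρ : ι → ℝ} {γw : ℝ}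

omit [DecidableEq ι] in
/-- the conjugated equation: if `Ax = v` then `conjForm A (e^{κρ}x) = ⟨e^{κρ}x, e^{κρ}v⟩`. [folklore] -/
theorem conjForm_solution (A : Matrix ι ι ℂ) (κ : ℝ) (ρ : ι → ℝ) {x v : ι → ℂ} (hx : A *ᵥ x = v) :
    conjForm A κ ρ (wvec κ ρ x) = star (wvec κ ρ x) ⬝ᵥ wvec κ ρ v :=
  conj_form_eq_dot A κ ρ hx

omit [DecidableEq ι] in
/-- **THE WEIGHTED-SOLUTION BOUND**: `γw·‖e^{κρ}x‖ ≤ ‖e^{κρ}v‖` for `Ax = v`. [folklore] -/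
theorem solution_bound (h : WCoercive A κ ρ γw) {x v : ι → ℂ} (hx : A *ᵥ x = v) :
    γw * Real.sqrt (nsq (wvec κ ρ x)) ≤ Real.sqrt (nsq (wvec κ ρ v)) := by
  set z := wvec κ ρ x with hz
  set w := wvec κ ρ v with hw
  have hcoer := h z
  rw [hz, conjForm_solution A κ ρ hx, ← hz, ← hw] at hcoer
  have hCS : (star z ⬝ᵥ w).re ≤ Real.sqrt (nsq z) * Real.sqrt (nsq w) := (Complex.re_le_norm _).trans (norm_star_dotProduct_le z w)
  have hZ0 : 0 ≤ Real.sqrt (nsq z) := Real.sqrt_nonneg _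
  by_cases hZ : Real.sqrt (nsq z) = 0
  · rw [hZ, mul_zero]; exact Real.sqrt_nonneg _
  · have hZpos : 0 < Real.sqrt (nsq z) := lt_of_le_of_ne hZ0 (Ne.symm hZ)
    have key : (γw * Real.sqrt (nsq z)) * Real.sqrt (nsq z) ≤ Real.sqrt (nsq w) * Real.sqrt (nsq z) := by
      calc (γw * Real.sqrt (nsq z)) * Real.sqrt (nsq z) = γw * nsq z := by rw [mul_assoc, Real.mul_self_sqrt (nsq_nonneg _)]
        _ ≤ Real.sqrt (nsq z) * Real.sqrt (nsq w) := hcoer.trans hCS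
        _ = Real.sqrt (nsq w) * Real.sqrt (nsq z) := mul_comm _ _
    exact le_of_mul_le_mul_right key hZpos

/-- **invertibility** from weighted coercivity with `γw > 0` (`Beta.AccretiveCombesThomas.isUnit_of_conjCoercive`). [folklore] -/
theorem isUnit (h : WCoercive A κ ρ γw) (hγ : 0 < γw) : IsUnit A := isUnit_of_conjCoercive hγ h

omit [DecidableEq ι] in
/-- **PAIRING DECAY**: for `Ax = v` with `v` supported in `{ρ ≤ 0}`, `u` in `{ρ ≥ R}`, `κ ≥ 0`: `|⟨u, x⟩| ≤ e^{−κR}/γw·‖u‖‖v‖` — this is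
`Beta.AccretiveCombesThomas.combesThomas_of_conjCoercive` read through the predicate. [folklore] -/
theorem pairing_decay (h : WCoercive A κ ρ γw) (hγ : 0 < γw) (hκ : 0 ≤ κ) {x v u : ι → ℂ} (hx : A *ᵥ x = v) {R : ℝ}
    (hu : ∀ e, u e ≠ 0 → R ≤ ρ e) (hv : ∀ e, v e ≠ 0 → ρ e ≤ 0) :
    ‖star u ⬝ᵥ x‖ ≤ Real.exp (-(κ * R)) / γw * (Real.sqrt (nsq u) * Real.sqrt (nsq v)) :=
  combesThomas_of_conjCoercive A ρ hγ hκ h hx hu hv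

/-- pairing decay read on the inverse. [folklore] -/
theorem pairing_decay_inv (h : WCoercive A κ ρ γw) (hγ : 0 < γw) (hκ : 0 ≤ κ) {v u : ι → ℂ} {R : ℝ}
    (hu : ∀ e, u e ≠ 0 → R ≤ ρ e) (hv : ∀ e, v e ≠ 0 → ρ e ≤ 0) :
    ‖star u ⬝ᵥ (A⁻¹ *ᵥ v)‖ ≤ Real.exp (-(κ * R)) / γw * (Real.sqrt (nsq u) * Real.sqrt (nsq v)) := by
  refine h.pairing_decay hγ hκ ?_ hu hv
  rw [Matrix.mulVec_mulVec, Matrix.mul_nonsing_inv A ((Matrix.isUnit_iff_isUnit_det A).mp (WCoercive.isUnit h hγ)), Matrix.one_mulVec]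

omit [DecidableEq ι] in
/-- **THE WEIGHTED-FORM BOUND**: with a conjugation defect `J` of `A`, `Re⟨z, Az⟩ ≤ (1/γw + J/γw²)·‖e^{κρ}v‖²` (`z = e^{κρ}x`, `Ax = v`). [folklore] -/
theorem form_bound (h : WCoercive A κ ρ γw) (hγ : 0 < γw) {J : ℝ} (hJ : ConjDefect A κ ρ J) (hJ0 : 0 ≤ J) {x v : ι → ℂ} (hx : A *ᵥ x = v) :
    (star (wvec κ ρ x) ⬝ᵥ (A *ᵥ wvec κ ρ x)).re ≤ (1 / γw + J / γw ^ 2) * nsq (wvec κ ρ v) := by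
  set z := wvec κ ρ x with hz
  set w := wvec κ ρ v with hw
  have hsol := h.solution_bound hx
  rw [← hz, ← hw] at hsol
  have hdef := hJ z
  rw [hz, conjForm_solution A κ ρ hx, ← hz, ← hw, abs_le] at hdef
  have hCS : (star z ⬝ᵥ w).re ≤ Real.sqrt (nsq z) * Real.sqrt (nsq w) := (Complex.re_le_norm _).trans (norm_star_dotProduct_le z w)
  set Z := Real.sqrt (nsq z)
  set W := Real.sqrt (nsq w)
  have hW0 : 0 ≤ W := Real.sqrt_nonneg _
  have hZ0 : 0 ≤ Z := Real.sqrt_nonneg _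
  have hZ2 : Z ^ 2 = nsq z := Real.sq_sqrt (nsq_nonneg _)
  have hW2 : W ^ 2 = nsq w := Real.sq_sqrt (nsq_nonneg _)
  have hZle : Z ≤ W / γw := by rw [le_div_iff₀ hγ, mul_comm]; exact hsol
  have hform : (star z ⬝ᵥ (A *ᵥ z)).re ≤ Z * W + J * Z ^ 2 := by rw [hZ2]; linarith [hdef.2]
  calc (star z ⬝ᵥ (A *ᵥ z)).re ≤ Z * W + J * Z ^ 2 := hform
    _ ≤ (W / γw) * W + J * (W / γw) ^ 2 := by gcongr
    _ = (1 / γw + J / γw ^ 2) * W ^ 2 := by ring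
    _ = (1 / γw + J / γw ^ 2) * nsq w := by rw [hW2]

omit [DecidableEq ι] in
/-- **THE WEIGHTED GRAM BOUND**: for `A = XᴴX + Y` with `Y ⪰ 0`, `‖X·e^{κρ}x‖² ≤ (1/γw + J/γw²)·‖e^{κρ}v‖²`. [folklore] -/
theorem gram_bound {υ : Type*} [Fintype υ] {Y : Matrix ι ι ℂ} {X : Matrix υ ι ℂ} (hAX : A = Xᴴ * X + Y) (hY : Y.PosSemidef)
    (h : WCoercive A κ ρ γw) (hγ : 0 < γw) {J : ℝ} (hJ : ConjDefect A κ ρ J) (hJ0 : 0 ≤ J) {x v : ι → ℂ} (hx : A *ᵥ x = v) :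
    nsq (X *ᵥ wvec κ ρ x) ≤ (1 / γw + J / γw ^ 2) * nsq (wvec κ ρ v) :=
  (nsq_le_re_form hAX hY _).trans (h.form_bound hγ hJ hJ0 hx)

end WCoercive

end Summit.QuantumFields.BalabanUV.T4Continuum.CTWeightedCoercivity

end
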